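import Literature.Probability.Percolation.SlabRSWProp39
import HarnessLib

/-!
# Newman–Tassion–Wu 2017, §3.3 — Proposition 3.9, item 1: the iteration

Topic: `Literature/Probability/Percolation`. Translation invariance of rectangle crossings in
the slab and the iterated form of Proposition 3.9 (1): with
`F_j = f_p(n + j m, n) = P_p[L ⟷ R in [0, n+jm] × [0, n]]`, for every `j ≥ 1`,
`((1 - √(1 - F_j)) · F_j)² ≤ K₁² K₂ · F_{j+1}`, i.e. `F_{j+1} ≥ h₂(F_j)` with the explicit
`h₂(x) = (x(1 - √(1-x)))² / (K₁² K₂)` of `SlabRSWProp39.lean` — hence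
`f_p(n + jκn, n) ≥ h₂^{j-1}(f_p(n + κn, n))`.

* `image_planarShift_boxR`, `real_lr_shift` — translation invariance of `f_p`.
* `prop39_item1` — PROVED: the inequality above for all `j ≥ 1`.

## Sources

* C. M. Newman, V. Tassion, W. Wu, *Critical percolation and the minimal spanning tree in slabs*,
  Comm. Pure Appl. Math. 70 (2017), arXiv:1512.09107: §3.3, Proposition 3.9 (1) ("the more
  general statement … follows by induction") [NewmanTassionWu2017].
-/

noncomputable section

namespace Literature.Probability.Percolation

open MeasureTheory LatticeModels SimpleGraph

namespace NTW17

variable {k : ℕ}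

/-- Translates of rectangles. [cite: NewmanTassionWu2017, §3.3 ("invariance under translation")] -/
theorem image_planarShift_boxR (v : ℤ × ℤ) (a b c d : ℤ) :
    planarShift v '' boxR a b c d = boxR (a + v.1) (b + v.1) (c + v.2) (d + v.2) := by
  ext z
  simp only [Set.mem_image, planarShift_apply, mem_boxR_iff]
  constructor
  · rintro ⟨w, hw, rfl⟩
    simp only [Prod.fst_add, Prod.snd_add]
    omega
  · intro hz
    refine ⟨z - v, by simp only [Prod.fst_sub, Prod.snd_sub]; omega, ?_⟩
    simp

/-- Translates of vertical lines. [cite: NewmanTassionWu2017, §3.3 ("invariance under translation")] -/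
theorem image_planarShift_col (v : ℤ × ℤ) (a : ℤ) :
    planarShift v '' {z : ℤ × ℤ | z.1 = a} = {z | z.1 = a + v.1} := by
  ext z
  simp only [Set.mem_image, planarShift_apply, Set.mem_setOf_eq]
  constructor
  · rintro ⟨w, hw, rfl⟩
    simp [hw]
  · intro hz
    exact ⟨z - v, by simp; omega, by simp⟩

/-- **Translation invariance of `f_p`**: the left-right crossing probability of a rectangle is
invariant under translations. [cite: NewmanTassionWu2017, §3.3 ("invariance under translation")] -/
theorem real_lr_shift (v : ℤ × ℤ) (a b c d : ℤ) (p : unitInterval) :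
    (bondPercolation (slabGraph 3 k) p).real
        (slabConn k (boxR (a + v.1) (b + v.1) (c + v.2) (d + v.2)) {z | z.1 = a + v.1} {z | z.1 = b + v.1}) =
      (bondPercolation (slabGraph 3 k) p).real (slabConn k (boxR a b c d) {z | z.1 = a} {z | z.1 = b}) := by
  rw [← image_planarShift_boxR v a b c d, ← image_planarShift_col v a, ← image_planarShift_col v b]
  exact real_slabConn_image k (planarShift v) (planarAdj_planarShift v) p _ _ _

/-- **NTW 2017, Proposition 3.9 (1), iterated linear form**: with
`F_j = P_p[L ⟷ R in [0, n+jm] × [0, n]]`, for `j ≥ 1` (and `2 ≤ h`, `2h ≤ n ≤ 2h+1`, `0 ≤ m`,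
`h + 4ρ + 8 < n + jm`, `ρ ≥ 4`, `k ≥ 1`, `0 < p < 1`):
`((1 - √(1 - F_j)) · F_j)² ≤ K₁² · K₂ · F_{j+1}`.
[cite: NewmanTassionWu2017, §3.3 (Proposition 3.9 (1))] -/
theorem prop39_item1 (hk : 1 ≤ k) {ρ : ℕ} (hρ : 4 ≤ ρ) {n m h : ℤ} {j : ℕ} (hj : 1 ≤ j)
    (hh : 2 ≤ h) (hn : 2 * h ≤ n) (hn' : n ≤ 2 * h + 1) (hm : 0 ≤ m)
    (hsep : h + 4 * ρ + 8 < n + j * m)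
    (p : unitInterval) (hp0 : 0 < (p : ℝ)) (hp1 : (p : ℝ) < 1) :
    ((1 - Real.sqrt (1 - (bondPercolation (slabGraph 3 k) p).real
        (slabConn k (boxR 0 (n + j * m) 0 n) {z | z.1 = 0} {z | z.1 = n + j * m}))) *
        (bondPercolation (slabGraph 3 k) p).real
          (slabConn k (boxR 0 (n + j * m) 0 n) {z | z.1 = 0} {z | z.1 = n + j * m})) ^ 2 ≤
      (1 + (2 / min (p : ℝ) (1 - p)) ^ (3 * ((5 * k + 4) * (2 * (6 * ρ + 4) + 1) ^ 2))) ^ 2 *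
        (1 + (2 / min (p : ℝ) (1 - p)) ^ (3 * ((5 * k + 4) * (2 * (2 * (3 * ρ + 3)) + 1) ^ 2))) *
        (bondPercolation (slabGraph 3 k) p).real
          (slabConn k (boxR 0 (n + (j + 1) * m) 0 n) {z | z.1 = 0} {z | z.1 = n + (j + 1) * m}) := by
  have hjm : 0 ≤ (j : ℤ) * m := mul_nonneg (by positivity) hm
  have hjm' : m ≤ (j : ℤ) * m := by
    have : (1 : ℤ) * m ≤ (j : ℤ) * m := mul_le_mul_of_nonneg_right (by exact_mod_cast hj) hm
    simpa using this
  have h := prop39_ind_step (k := k) hk hρ (n := n) (m := m) (M := j * m) (h := h) hh hn hn' hm hjm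
    (by omega) hsep p hp0 hp1
  -- translate `[-m, n+jm] × [0,n]` to `[0, n+(j+1)m] × [0,n]`
  have ht := real_lr_shift (k := k) (m, 0) (-m) (n + j * m) 0 n p
  simp only at ht
  rw [show -m + m = 0 by ring, show n + ↑j * m + m = n + (↑j + 1) * m by ring, add_zero,
    show n + (0 : ℤ) = n by ring] at ht
  rw [ht]
  exact h

end NTW17

end Literature.Probability.Percolation
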